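import Summits.CriticalPhenomena.PercolationContinuityZ3.Theorems.Transplant.PlanarSkeletonFrmQuasiDefs
import Summits.CriticalPhenomena.PercolationContinuityZ3.Theorems.Transplant.SkelFrmQuasiBParamsCorrKGLen
import Summits.CriticalPhenomena.PercolationContinuityZ3.Theorems.Transplant.SkelFrmBParamsCorrKGLen
import Summits.CriticalPhenomena.PercolationContinuityZ3.Theorems.Transplant.SkelNegParamsLattice
import Summits.CriticalPhenomena.PercolationContinuityZ3.Theorems.Transplant.SkelFrmQuasi1ParamsLBL
import Summits.CriticalPhenomena.PercolationContinuityZ3.Theorems.Transplant.SkelFrmQuasi1ParamsPO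
import Summits.CriticalPhenomena.PercolationContinuityZ3.Theorems.Transplant.SkelFrmQuasiBChoiceNums
import Summits.CriticalPhenomena.PercolationContinuityZ3.Theorems.Transplant.SkelFrmQuasiBParamsCorrKG
import Summits.CriticalPhenomena.PercolationContinuityZ3.Theorems.Transplant.SkelFrmQuasiBParamsCorrKG0
import Summits.CriticalPhenomena.PercolationContinuityZ3.Theorems.Transplant.SkelFrmQuasiBParamsCorrKGY
import Summits.CriticalPhenomena.PercolationContinuityZ3.Theorems.Transplant.SkelFrmQuasiBParamsLF
import HarnessLib
import Summits.CriticalPhenomena.PercolationContinuityZ3.Theorems.Transplant.SkelFrmBParamsCorrKGLenY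
/-!
# GEN-Q PORT (WAVE-Q table v0.8 section 2, row G050, U-level L9; captain R-6/R-7 2026-08-27: carrier token swap `PlanarSkeletonFrmFrom ↦ PlanarSkeletonFrmQuasi`)
# of the tree module «Transplant/SkelFrmFromBParamsCorrKGLenY» (sha256 d8af254200c46aff…) onto the quasi-step carrier `PlanarSkeletonFrmQuasi` (p507026): «SkelFrmQuasiBParamsCorrKGLenY»

HAND HUNK (L-FLOORMAP-1 ①, reader of G017 «SkelFrmQuasiBChoiceNums» through G023's `kgR/gFloorKG`): `KS0.R'0 κ Φ … ↦ KS0.R'0N κ Φ (KS.NQ Φ) …` at the 3 unfolded site(s) in the proofs.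

ORIGINAL TITLE: N2 (frames-only node `SamePDropOfSkeletonFrmFrom₁`, OPEN) — (ζ″) ledger, THE K-G CORRIDOR'S LENGTH BUDGET, SECOND AXIS: closed bounds on p5-g16's

builds on p205010 (kernel theorem, internal audit signed; external expert review pending) — nothing in this file uses p205010; NOTHING is claimed about any open node
((N3-b), the end state).  Lane `prim-bschramm`, seat `prim-bschramm-stmt` (gen 33; GEN-Q column pen; tool = captain gen-1 g4's port_genq.py R-14 --cone + p3-g30's T1 patch).  Helper file (`--supports stmt-CriticalPhenomena-4575 --as helper`).
PORT RULES (U-wave r1–r4 re-used, GEN-Q hunk classes of p3-g29 #6136): declaration order, names and proof texts are those of «SkelFrmFromBParamsCorrKGLenY», byte-identical except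
(i) the carrier token `PlanarSkeletonFrmFrom ↦ PlanarSkeletonFrmQuasi` in binders, `namespace`/`end` lines and qualified names (module names `SkelFrmFrom… ↦ SkelFrmQuasi…`
in imports of already-ported rows); (ii) `Φ.step ↦ Φ.qstep` with the called Steps lemma replaced by its `…Q`/`_q` twin and the cost `Φ.M` threaded (none in this file unless
listed below); (iii) `Φ.cyl_connected ↦ Φ.cyl_reach` readers (none unless listed); (iv) graph-ball radii / window floors ×`Φ.M` (none unless listed).  Carrier-free
residents stay imported/exported from the original «SkelFrmBParamsCorrKGLenY» exactly as in the FrmFrom port.  Docstrings and citations are the original's.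

-/

open scoped Classical

noncomputable section

namespace Summit.CriticalPhenomena.PercolationContinuityZ3.Theorems.Transplant

namespace Skelφ

/-! ## §1 Generic budgets over `KGYRows` -/

section BudgetY

variable {n ℓ : ℕ} {hs v : ℤ} {R' ρ q W : ℕ}

end BudgetY

end Skelφ

/-! ## §2 At the values of record (`ρ := 0`): the second-axis run length and budget -/

namespace PlanarSkeletonFrmQuasi

namespace NegB

open Literature.Probability.Percolation Literature.Probability.LatticeModels SimpleGraph
open SkelConc (Consts)
open Skelφ (shearUnit kgSL kgSLY kgΔY kgNY kgFarY kgTY kgM₁Y kgM₂Y KGYRows)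
open Neg

section ValuesY

variable (κ : Consts) {V : Type} [DecidableEq V] [Countable V] {G : SimpleGraph V} [G.LocallyFinite] (Φ : PlanarSkeletonFrmQuasi G) (t : V) (p : unitInterval)
  (D : Skelφ.StepI.DataNS V) (g f mk qx Wx : ℕ)

/-- **The second-axis residual floors**: `qx ≤ 40·sL` (rows) and `Wx ≤ 40·n_L` (x′ units). [this work] -/
structure KGResY : Prop where
  /-- `qx ≤ 40·sL` -/
  hqx : (qx : ℤ) ≤ 40 * kgSLY (nL κ Φ t p D g f) (ℓL κ Φ t p D g f) (hL κ Φ t p D g f)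
  /-- `Wx ≤ 40·n_L` -/
  hWx : Wx ≤ 40 * nL κ Φ t p D g f

/-- The generic floors at the values, second axis (`ρ := 0`): `3(2R′+0) ≤ n_L`, `3(2R′+0) ≤ sL`, `8R′ ≤ n_L`, `958 ≤ sL`, `0 ≤ P + 2`. [folklore] -/
theorem kgY_floors (κ : Consts) {V : Type} [DecidableEq V] [Countable V] {G : SimpleGraph V} [G.LocallyFinite] (Φ : PlanarSkeletonFrmQuasi G) (t : V) (p : unitInterval) (D : Skelφ.StepI.DataNS V) (g : ℕ) (f : ℕ) (mk : ℕ) (hN : EqNumL κ Φ t p D g f) (hg : gFloorKG κ Φ t p D mk ≤ g) :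
    3 * (2 * ((kgR κ Φ t p D mk : ℕ) : ℤ) + ((0 : ℕ) : ℤ)) ≤ (nL κ Φ t p D g f : ℤ) ∧
    3 * (2 * ((kgR κ Φ t p D mk : ℕ) : ℤ) + ((0 : ℕ) : ℤ)) ≤ kgSLY (nL κ Φ t p D g f) (ℓL κ Φ t p D g f) (hL κ Φ t p D g f) ∧
    8 * ((kgR κ Φ t p D mk : ℕ) : ℤ) ≤ (nL κ Φ t p D g f : ℤ) ∧
    958 ≤ kgSLY (nL κ Φ t p D g f) (ℓL κ Φ t p D g f) (hL κ Φ t p D g f) ∧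
    (((0 : ℕ) : ℤ)) ≤ ((nL κ Φ t p D g f * ℓL κ Φ t p D g f / shearUnit (nL κ Φ t p D g f) (hL κ Φ t p D g f) : ℕ) : ℤ) + 2 := by
  have hnle := hN.n_le
  have hgML : g ≤ ML κ Φ t p D g := (ML_le_ML κ Φ t p D g).2
  have hsL := ML_sub_one_le_kgSL κ Φ t p D g f hN
  have h960 := slack_floor_le_ML κ Φ t p D g
  have h959 : (959 : ℤ) ≤ ML κ Φ t p D g := by
    have : 959 ≤ ML κ Φ t p D g := by omega
    exact_mod_cast this
  unfold gFloorKG at hg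
  have hfl : ((8 * KS0.R'0N κ Φ (KS.NQ Φ) t p D mk + 3 * Mu D + 6 : ℕ) : ℤ) ≤ ML κ Φ t p D g := by exact_mod_cast hg.trans hgML
  push_cast at hfl
  rw [kgSLY_eq_kgSL]
  unfold kgR
  have hM0 : (0 : ℤ) ≤ (Mu D : ℤ) := by positivity
  push_cast
  refine ⟨by linarith, by linarith, by linarith, by linarith, by positivity⟩

/-- **`pitchY ≤ 20·K·(sL + 2)`** (`m ≤ n_L·ℓ_L` by `modulus_vβOf`, and `n_Lℓ_L ≤ (sL + 2)·U − 2`). [this work] -/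
theorem pitchY_le (κ : Consts) {V : Type} [DecidableEq V] [Countable V] {G : SimpleGraph V} [G.LocallyFinite] (Φ : PlanarSkeletonFrmQuasi G) (t : V) (p : unitInterval) (D : Skelφ.StepI.DataNS V) (g : ℕ) (f : ℕ) (hN : EqNumL κ Φ t p D g f) :
    pitchY κ Φ t p D g f ≤ 20 * (Neg.K κ : ℤ) * (kgSLY (nL κ Φ t p D g f) (ℓL κ Φ t p D g f) (hL κ Φ t p D g f) + 2) := by
  obtain ⟨hn1, -⟩ := one_le_of_eqNumL κ Φ t p D g f hN
  have hm := (Skelφ.NegPrm.modulus_vβOf hn1 (hL κ Φ t p D g f) (ℓL κ Φ t p D g f) (vL κ Φ t p D g f)).2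
  have hU : (0 : ℤ) < (shearUnit (nL κ Φ t p D g f) (hL κ Φ t p D g f) : ℕ) := Skelφ.shearUnit_pos hn1 _
  have hK0 : (0 : ℤ) ≤ (Neg.K κ : ℤ) := by positivity
  unfold pitchY
  -- sL = ⌊(nℓ − U + 1)/U⌋ ⇒ nℓ − U + 1 < (sL + 1)·U ⇒ nℓ ≤ (sL + 2)·U − 2
  have hlt := Int.lt_ediv_add_one_mul_self ((nL κ Φ t p D g f : ℤ) * ℓL κ Φ t p D g f - (shearUnit (nL κ Φ t p D g f) (hL κ Φ t p D g f) : ℕ) + 1) hU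
  have e : ((nL κ Φ t p D g f : ℤ) * ℓL κ Φ t p D g f - (shearUnit (nL κ Φ t p D g f) (hL κ Φ t p D g f) : ℕ) + 1) /
      (shearUnit (nL κ Φ t p D g f) (hL κ Φ t p D g f) : ℕ) = kgSLY (nL κ Φ t p D g f) (ℓL κ Φ t p D g f) (hL κ Φ t p D g f) := rfl
  rw [e] at hlt
  apply Int.ediv_le_of_le_mul hU
  have : vβL κ Φ t p D g f = Skelφ.NegPrm.vβOf (nL κ Φ t p D g f) (hL κ Φ t p D g f) (ℓL κ Φ t p D g f) (vL κ Φ t p D g f) := rfl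
  rw [this]
  nlinarith

/-- **`kgNYv0 ≤ 21·K + 2`**. [this work] -/
theorem kgNYv0_le (κ : Consts) {V : Type} [DecidableEq V] [Countable V] {G : SimpleGraph V} [G.LocallyFinite] (Φ : PlanarSkeletonFrmQuasi G) (t : V) (p : unitInterval) (D : Skelφ.StepI.DataNS V) (g : ℕ) (f : ℕ) (mk : ℕ) (qx : ℕ) (Wx : ℕ) (hN : EqNumL κ Φ t p D g f) (hg : gFloorKG κ Φ t p D mk ≤ g) : kgNYv0 κ Φ t p D g f mk qx Wx ≤ 21 * Neg.K κ + 2 := by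
  refine (kgNYv0_le_div κ Φ t p D g f mk qx Wx).trans ?_
  obtain ⟨hn1, -⟩ := one_le_of_eqNumL κ Φ t p D g f hN
  obtain ⟨-, hS, -, hbig, -⟩ := kgY_floors κ Φ t p D g f mk hN hg
  have H := kgYRows0_of κ Φ t p D g f mk qx Wx hN hg
  have hP := H.sL_le_kgP
  have hpy := pitchY_le κ Φ t p D g f hN
  have hK := (Skelφ.NegPrm.forty_le_Kcell κ.K₀).1
  have hK' : (40 : ℤ) ≤ (Neg.K κ : ℤ) := by unfold Neg.K; exact_mod_cast hK
  set s := kgSLY (nL κ Φ t p D g f) (ℓL κ Φ t p D g f) (hL κ Φ t p D g f) with hs_def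
  have hs0 : 0 ≤ s := by linarith
  have hPd := Skelφ.natDiv_le_kgSLY hn1 (ℓL κ Φ t p D g f) (hL κ Φ t p D g f)
  have hPd0 : (0 : ℤ) ≤ ((nL κ Φ t p D g f * ℓL κ Φ t p D g f / shearUnit (nL κ Φ t p D g f) (hL κ Φ t p D g f) : ℕ) : ℤ) := by positivity
  set Pd := ((nL κ Φ t p D g f * ℓL κ Φ t p D g f / shearUnit (nL κ Φ t p D g f) (hL κ Φ t p D g f) : ℕ) : ℤ) with hPd_def
  have hR6 : 6 * ((KS0.R'0N κ Φ (KS.NQ Φ) t p D mk : ℕ) : ℤ) ≤ s := by unfold kgR at hS; push_cast at hS; linarith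
  have hsk : 40 * (Neg.K κ : ℤ) + 3 ≤ s * (Neg.K κ : ℤ) - s := by
    nlinarith [mul_nonneg (sub_nonneg.2 hbig) (sub_nonneg.2 (show (1 : ℤ) ≤ (Neg.K κ : ℤ) by linarith))]
  have hT1 : (((nL κ Φ t p D g f * ℓL κ Φ t p D g f / shearUnit (nL κ Φ t p D g f) (hL κ Φ t p D g f) + 1 : ℕ) : ℤ) - 1) / 2 ≤ s + 1 := by
    have e : (((nL κ Φ t p D g f * ℓL κ Φ t p D g f / shearUnit (nL κ Φ t p D g f) (hL κ Φ t p D g f) + 1 : ℕ) : ℤ) - 1) = Pd := by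
      rw [hPd_def]; push_cast; ring
    rw [e]
    have := Int.ediv_le_self 2 hPd0
    linarith
  have hT2 : (s + kgΔY (kgR κ Φ t p D mk) 0) / 2 ≤ s + kgΔY (kgR κ Φ t p D mk) 0 :=
    Int.ediv_le_self 2 (by unfold Skelφ.kgΔY; positivity)
  have hΔ : kgΔY (kgR κ Φ t p D mk) 0 = 3 * ((KS0.R'0N κ Φ (KS.NQ Φ) t p D mk : ℕ) : ℤ) + 2 := by unfold Skelφ.kgΔY kgR; push_cast; ring
  have htgt : kgTgtY0 κ Φ t p D g f mk ≤ s * (21 * Neg.K κ + 2) := by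
    unfold kgTgtY0
    rw [hΔ] at hT2
    rw [hΔ]
    nlinarith
  have h0 : 0 ≤ kgTgtY0 κ Φ t p D g f mk := by
    unfold kgTgtY0
    have hpy0 : 0 ≤ pitchY κ Φ t p D g f := by
      unfold pitchY
      apply Int.ediv_nonneg _ (by positivity)
      have hm0 := (Skelφ.NegPrm.modulus_vβOf_pos hn1 (one_le_of_eqNumL κ Φ t p D g f hN).2 (hL κ Φ t p D g f) (vL κ Φ t p D g f)).le
      have : vβL κ Φ t p D g f = Skelφ.NegPrm.vβOf (nL κ Φ t p D g f) (hL κ Φ t p D g f) (ℓL κ Φ t p D g f) (vL κ Φ t p D g f) := rfl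
      rw [this]; positivity
    have h1 : (0 : ℤ) ≤ ((((nL κ Φ t p D g f * ℓL κ Φ t p D g f / shearUnit (nL κ Φ t p D g f) (hL κ Φ t p D g f) + 1 : ℕ) : ℤ) - 1)) / 2 :=
      Int.ediv_nonneg (by have h' := hPd0; rw [hPd_def] at h'; push_cast at h' ⊢; linarith) (by norm_num)
    have h2 : (0 : ℤ) ≤ (s + kgΔY (kgR κ Φ t p D mk) 0) / 2 := Int.ediv_nonneg (by unfold Skelφ.kgΔY; positivity) (by norm_num)
    linarith
  have hcast : (((kgTgtY0 κ Φ t p D g f mk).toNat : ℕ) : ℤ) ≤ ((s.toNat * (21 * Neg.K κ + 2) : ℕ) : ℤ) := by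
    rw [Int.toNat_of_nonneg h0]; push_cast; rw [Int.toNat_of_nonneg hs0]; exact htgt
  exact Nat.div_le_of_le_mul (by exact_mod_cast hcast)

-- GEN-Q (R-2, captain 2026-08-27): `PlanarSkeletonFrmFrom.NegB.kgSchedNY_le_LfQ` is not in the used cone of the node top — not ported.

end ValuesY

end NegB

end PlanarSkeletonFrmQuasi

end Summit.CriticalPhenomena.PercolationContinuityZ3.Theorems.Transplant

end
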